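import Summits.BirchSwinnertonDyer.BirchSwinnertonDyer.Theorems.EisensteinPrimesMazurMCOnCellBTwistbackSubrowPartnerGiven
import Summits.BirchSwinnertonDyer.BirchSwinnertonDyer.Theorems.EisensteinPrimesMazurMCOnCellBTwistbackKLFieldSupply
import Summits.BirchSwinnertonDyer.BirchSwinnertonDyer.Theorems.EisensteinPrimesMazurMCOnCellBTwistbackKLFieldSupplyClassNumber
import Literature.NumberTheory.LFunctions.PrimitiveQuadraticCharacterKroneckerEven
import HarnessLib

/-!
# Crux 3 `MazurMCOnCellB` (stmt-BirchSwinnertonDyer-19033), line `twistback` v4 — the SUB-ROW ASSEMBLY, part 3b: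
# stub 6 (∃-PARTNER) AT EVERY NON-SPLIT X2b PAIR `(W, 3)` WITH A BALANCE-ONE LINE DATUM — the field `K` is
# CHOSEN (Nakagawa–Horie / Taya), not given; no per-pair analytic rank, `p`-adic `L`-function, height or Schneider
# hypothesis

LEAD bsd-line-x2-p1 g11 (2026-08-28). HONEST FRAMING (cell `bsd-eis`, run/shared/lean/pub/bsd-eis/): conditional
theorems only. Named facts taken as hypotheses BY NAME (nothing asserted, nothing introduced): the route's
`PublishedInputs` (stmt-…-19037), Disegni 2020 Thm. 4(1) (PUB), Greenberg–Vatsal Thm. (3.11) (PUB), Dokchitser–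
Dokchitser 2010 Thm. 1.4 (`selmerCorank_mod_two_eq`, PUB), Nakagawa–Horie 1988 Thm. 1 + Taya 2000
(`nakagawaHorie_taya_exists_imaginary_h3_eq_one`, PUB; relocated fact of w6's p65xxxx `…KLFieldSupply`), and the
`p`-converse at a multiplicative Eisenstein prime `KellerYin2024.thmE_pConverse_semistable_OPEN` (Keller–Yin
arXiv:2402.12781v2 Thm. E — an UNREFEREED PREPRINT resting on Castella arXiv:2409.01360; every `_of_thmE` theorem
below is conditional on it; the line already carries Keller–Yin Thm. D as stub 3a). `--supports`
stmt-BirchSwinnertonDyer-19033; no `def`, no `sorry`; closes no registered stub (stub 6 quantifies over ALL X2b pairs;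
this file serves the SUB-ROW «p = 3, non-split, local balance 1, given a line datum»); no summit statement, no
Mazur main conjecture and no BSD is proved for any curve unconditionally; 0 cells / labels / tiers move.

WHAT. Parts 1–2 (`…TwistbackSubrowCarrier{,Even}`, p653533 / p653853) turned the binder `hKL` of the doors into a
THEOREM about `(E, K)`: a KL-flat balance-1 carrier of EVERY minimal model of `E^{(d_K)}` from a balance-1 line datum
of `E`, an admissible `K` with `d_K ≡ 1 (mod 4)` prime to the levels, and ONE class number. This file plugs it into
the doors and then CHOOSES `K`:

* (part 3a `…TwistbackSubrowPartnerGiven`: §1/§2, `K` given, both shapes, PUB door with `r_an(E^{(d_K)}) = 1` and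
  w5's door with Keller–Yin Thm. E.)
* §3 `exists_admissibleField_coprime_classNumber` — the field supply in the carrier's currency — and, `K` CHOSEN,
  **`upperPartner_at_three_of_ramifiedOdd_of_thmE`** / **`upperPartner_at_three_of_unramifiedEven_of_thmE`**: for
  EVERY globally minimal `W` with `X2.CellB W 3`, `3` NON-split, a rational line of either X2b shape with primitive
  characters `(φ, ψ)` and a finite set of places `S₀ ∌ (3)` off which `W` is good with LOCAL BALANCE ONE — the
  conclusion of `stub_upperPartner` AT `(W, 3)`, VERBATIM. Inside: the unramified even character is quadratic
  (`𝔽₃`), even (parity lemma), non-trivial (its value at `3` is `−1`, w7), so its level `D` is a positive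
  fundamental discriminant (complex avatar, w3 g7 +
  `isFundamentalDiscriminant_of_even`); Nakagawa–Horie–Taya (w6 `exists_heegnerField_threeClassNumberTrivial` with
  `A = N_W · m · d · ∏_{S₀} ℓ_v`) supplies `K` Heegner for `24·A·D` with `d_K ≡ 1 (mod 24AD)` and `h₃(D·d_K) = 1`;
  w6's `not_three_dvd_classNumber_mul` converts the class number; parts 1–2 build `hKL`; w5's door concludes.

HONEST REMAINDER on this sub-row after this file: the LINE DATUM itself (two primitive Dirichlet characters acting on
a rational line of `W[3]` — class-field theory for quadratic characters; per pair a certificate, cf. the X3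
line-certificate files) and the named facts above (ONE preprint: Keller–Yin Thm. E; with `r_an(E^{(d_K)}) = 1` as a
per-pair input instead, §1/§2 are PUB-only but `K` is then given, not chosen). Split pairs and balance `≠ 1` are not
served. Stub 6 as registered (ALL X2b pairs, all `p`) stays OPEN.

References: [GreenbergVatsal2000] Thm. (1.3), §2 p. 28, §3 Thm. (3.11); [NakagawaHorie1988] Thm. 1; [KrizLi2019] §9
Def. 9.1, Thm. 9.2, Prop. 9.3, Thm. 9.4 (first assertion); [KellerYin2024] Thm. E (PRE); [DokchitserDokchitserAnnals2010]
Thm. 1.4; [Disegni2020] Thm. 4; [Wuthrich2014] Thm. 16; [MontgomeryVaughan2007] Thm. 9.13; [Cox2013] Thm. 7.7.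
-/

set_option autoImplicit false

-- `Summit.BirchSwinnertonDyer.BirchSwinnertonDyer.…`: the summit and its single sub-problem share a name.
set_option linter.dupNamespace false

noncomputable section

open scoped Classical MatrixGroups ModularForm NumberTheorySymbols

open CongruenceSubgroup WeierstrassCurve NumberField IsDedekindDomain Field DirichletCharacter Rat.HeightOneSpectrum
  Literature.NumberTheory.EllipticCurves Literature.NumberTheory.GaloisRepresentations
  Literature.NumberTheory.EllipticCurves.ModularForms Literature.NumberTheory.QuadraticFields
  Literature.NumberTheory.EllipticCurves.Rank1Residual Literature.NumberTheory.EllipticCurves.Rank1Residual.Typed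
  Literature.NumberTheory.EllipticCurves.Wuthrich2014 Literature.NumberTheory.EllipticCurves.GreenbergVatsal2000
  Literature.NumberTheory.EllipticCurves.Disegni2020 Literature.NumberTheory.EllipticCurves.KellerYin2024
  Literature.NumberTheory.EllipticCurves.KrizLi2019 Literature.NumberTheory.LFunctions
  Summit.BirchSwinnertonDyer.Rank1Residual Summit.BirchSwinnertonDyer.Rank1Residual.X2
  Summit.BirchSwinnertonDyer.BirchSwinnertonDyer.Theses
  Summit.BirchSwinnertonDyer.BirchSwinnertonDyer.Theorems.EisensteinPrimesLineWeilRelation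
  Summit.BirchSwinnertonDyer.BirchSwinnertonDyer.Theorems.EisensteinPrimesMazurMCOnCellBTwistbackKLFlatPartner
  Summit.BirchSwinnertonDyer.BirchSwinnertonDyer.Theorems.EisensteinPrimesMazurMCOnCellBTwistbackLamOnePartner
  Summit.BirchSwinnertonDyer.BirchSwinnertonDyer.Theorems.EisensteinPrimesMazurMCOnCellBTwistbackSubrowCarrier
  Summit.BirchSwinnertonDyer.BirchSwinnertonDyer.Theorems.EisensteinPrimesMazurMCOnCellBTwistbackSubrowCarrierEven
  Summit.BirchSwinnertonDyer.BirchSwinnertonDyer.Theorems.EisensteinPrimesMazurMCOnCellBTwistbackKLFieldSupply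
  Summit.BirchSwinnertonDyer.BirchSwinnertonDyer.Theorems.EisensteinPrimesMazurMCOnCellBTwistbackKLFieldSupplyClassNumber
  Summit.BirchSwinnertonDyer.BirchSwinnertonDyer.Theorems.EisensteinPrimesMazurMCOnCellBTwistbackPartnerClassNumberLift
  Summit.BirchSwinnertonDyer.BirchSwinnertonDyer.Theorems.EisensteinPrimesLinePsiAtMultiplicativePrime
  Summit.BirchSwinnertonDyer.BirchSwinnertonDyer.Theorems.EisensteinPrimesLinePhiAtMultiplicativePrime

  Summit.BirchSwinnertonDyer.BirchSwinnertonDyer.Theorems.EisensteinPrimesMazurMCOnCellBTwistbackSubrowPartnerGiven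

namespace Summit.BirchSwinnertonDyer.BirchSwinnertonDyer.Theorems.EisensteinPrimesMazurMCOnCellBTwistbackSubrowPartner

/-! ## §3. `p = 3`: the field `K` is CHOSEN (Nakagawa–Horie–Taya) — stub 6 at `(W, 3)` from the line datum alone -/

section Three

variable (W : WeierstrassCurve ℚ) [W.IsElliptic] [W.IsGloballyMinimal]

/-- **The field supply in the carrier's currency.** For a level `n` carrying an EVEN PRIMITIVE quadratic-valued
character `θ : (ℤ/n)ˣ → 𝔽₃ˣ` with `θ(3) = −1` (so `n > 1` and `n` is a POSITIVE FUNDAMENTAL DISCRIMINANT — complex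
avatar + Montgomery–Vaughan Thm. 9.13), any auxiliary levels `m₁`, `N₁` and any finite set of places `S₀`:
Nakagawa–Horie–Taya (w6's `exists_heegnerField_threeClassNumberTrivial` at `A = N₁·m₁·n·∏_{S₀} ℓ_v`) give an imaginary
quadratic `K` with `d_K` odd, `< −4`, Heegner for `N₁`, for `3` and for a level divisible by every `ℓ_v` (`v ∈ S₀`),
`gcd(m₁, d_K) = gcd(n, d_K) = 1`, and `3 ∤ h(−n·|d_K|)` (w6's `not_three_dvd_classNumber_mul`). CONDITIONAL on the
named fact `hNH`. [cite: NakagawaHorie1988, Thm. 1] [cite: KrizLi2019, §9 Thm. 9.2, Prop. 9.3 and the proof of Thm. 9.4]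
[cite: MontgomeryVaughan2007, §9.3 Thm. 9.13] [cite: Cox2013, Thm. 7.7 (ii)] -/
theorem exists_admissibleField_coprime_classNumber
    (hNH : Literature.NumberTheory.QuadraticFields.nakagawaHorie_taya_exists_imaginary_h3_eq_one)
    (N₁ : ℕ) (hN₁ : 0 < N₁) (m₁ : ℕ) [NeZero m₁] {n : ℕ} [NeZero n] (θ : DirichletCharacter (ZMod 3) n)
    (hprim : θ.IsPrimitive) (heven : θ.Even) (hθ3 : θ (3 : ZMod n) = -1)
    (S₀ : Finset (HeightOneSpectrum (𝓞 ℚ))) :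
    ∃ (K : Type) (_ : Field K) (_ : NumberField K), IsImaginaryQuadratic K ∧
      SatisfiesHeegnerHypothesis N₁ K ∧ SatisfiesHeegnerHypothesis 3 K ∧
      Odd (NumberField.discr K) ∧ NumberField.discr K < -4 ∧
      (∃ N₀ : ℕ, SatisfiesHeegnerHypothesis N₀ K ∧ ∀ v ∈ S₀, Rat.HeightOneSpectrum.natGenerator v ∣ N₀) ∧
      m₁.Coprime (NumberField.discr K).natAbs ∧ n.Coprime (NumberField.discr K).natAbs ∧
      ¬ 3 ∣ BinaryQuadraticForm.classNumber (-((n * (NumberField.discr K).natAbs : ℕ) : ℤ)) := by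
  -- `n > 1`: `θ` is non-trivial
  have hn1 : 1 < n := by
    by_contra hle
    have hn : n = 1 := le_antisymm (not_lt.mp hle) (Nat.pos_of_ne_zero (NeZero.ne n))
    subst hn
    have h1 : θ (3 : ZMod 1) = 1 := by
      rw [Subsingleton.elim (3 : ZMod 1) 1, map_one]
    rw [h1] at hθ3
    exact absurd hθ3 (by decide)
  -- `n` is a positive fundamental discriminant (complex avatar of `θ`)
  obtain ⟨χc, F, hχcq, -, -, hcond, -, hevc⟩ := exists_complex_avatar 3 (by decide) θ (isQuadratic_of_zmod_three θ)
  have hprimc : χc.IsPrimitive := by rw [isPrimitive_def, hcond]; exact hprim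
  have hDf := PrimitiveQuadratic.isFundamentalDiscriminant_of_even hprimc hχcq (hevc heven) hn1
  have hD0 : (0 : ℤ) < (n : ℤ) := by exact_mod_cast Nat.pos_of_ne_zero (NeZero.ne n)
  -- Nakagawa–Horie–Taya at `A = N₁ · m₁ · n · ∏ ℓ_v`
  obtain ⟨L, hL⟩ : ∃ L : ℕ, L = ∏ v ∈ S₀, Rat.HeightOneSpectrum.natGenerator v := ⟨_, rfl⟩
  have hL0 : 0 < L := by rw [hL]; exact Finset.prod_pos fun v _ ↦ (prime_natGenerator v).pos
  obtain ⟨A, hA⟩ : ∃ A : ℕ, A = N₁ * m₁ * n * L := ⟨_, rfl⟩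
  have hA0 : 0 < A := by
    have := Nat.pos_of_ne_zero (NeZero.ne m₁)
    have := Nat.pos_of_ne_zero (NeZero.ne n)
    rw [hA]; positivity
  obtain ⟨K, iF, iN, hK, -, hlt, hmod, hoddK, hH, h3⟩ := exists_heegnerField_threeClassNumberTrivial hNH hD0 hDf hA0 0
  have hnabs : ((n : ℤ)).natAbs = n := Int.natAbs_natCast n
  rw [hnabs] at hH
  -- the modulus `24·A·n` and its divisors
  have hM : ((24 * A * n : ℕ) : ℤ) = 24 * (A : ℤ) * (n : ℤ) := by push_cast; ring
  have hmod' : NumberField.discr K ≡ 1 [ZMOD ((24 * A * n : ℕ) : ℤ)] := by rw [hM]; exact hmod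
  have hdN₁ : N₁ ∣ 24 * A * n := ⟨24 * m₁ * n * L * n, by rw [hA]; ring⟩
  have hd3 : 3 ∣ 24 * A * n := ⟨8 * A * n, by ring⟩
  have hdm₁ : m₁ ∣ 24 * A * n := ⟨24 * N₁ * n * L * n, by rw [hA]; ring⟩
  have hdn : n ∣ 24 * A * n := ⟨24 * A, by ring⟩
  have hdL : L ∣ 24 * A * n := ⟨24 * N₁ * m₁ * n * n, by rw [hA]; ring⟩
  have hHN₁ : SatisfiesHeegnerHypothesis N₁ K := hH.of_dvd hdN₁
  have hH3 : SatisfiesHeegnerHypothesis 3 K := hH.of_dvd hd3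
  have hS₀ : ∀ v ∈ S₀, Rat.HeightOneSpectrum.natGenerator v ∣ 24 * A * n := by
    intro v hv
    have hvL : Rat.HeightOneSpectrum.natGenerator v ∣ L := by
      rw [hL]; exact Finset.dvd_prod_of_mem _ hv
    exact hvL.trans hdL
  have hm₁K : m₁.Coprime (NumberField.discr K).natAbs :=
    coprime_natAbs_of_modEq_one hmod' (Int.natCast_dvd_natCast.mpr hdm₁)
  have hnK : n.Coprime (NumberField.discr K).natAbs :=
    coprime_natAbs_of_modEq_one hmod' (Int.natCast_dvd_natCast.mpr hdn)
  -- the class number in the carrier's currency: `−(n·|d_K|) = n·d_K`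
  have h2 : Module.finrank ℚ K = 2 := hK.1
  have hD0K : NumberField.discr K < 0 := hK.discr_neg
  have hK4 : NumberField.discr K % 4 = 1 := discr_emod_four_eq_one_of_odd h2 hoddK
  have hsfK : Squarefree (NumberField.discr K) := by
    rcases Quadratic.isFundamentalDiscriminant_discr (K := K) h2 with ⟨-, hsf, -⟩ | ⟨h4, -, -⟩
    · exact hsf
    · exfalso; omega
  have hcop : IsCoprime (NumberField.discr K) (n : ℤ) := by
    rw [Int.isCoprime_iff_gcd_eq_one, Int.gcd_eq_natAbs, Int.natAbs_natCast]
    exact hnK.symm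
  have hcn := (not_three_dvd_classNumber_mul hD0 hDf hlt hK4 hsfK hcop h3).1
  have heq : (-((n * (NumberField.discr K).natAbs : ℕ) : ℤ)) = (n : ℤ) * NumberField.discr K := by
    push_cast
    rw [abs_of_neg hD0K]
    ring
  have hclass : ¬ 3 ∣ BinaryQuadraticForm.classNumber (-((n * (NumberField.discr K).natAbs : ℕ) : ℤ)) := by
    rw [heq]; exact hcn
  exact ⟨K, iF, iN, hK, hHN₁, hH3, hoddK, hlt, ⟨24 * A * n, hH, hS₀⟩, hm₁K, hnK, hclass⟩

/-- **Stub 6 (∃-PARTNER) at EVERY non-split X2b pair `(W, 3)` with a balance-one RAMIFIED-ODD line datum — `K`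
CHOSEN.** For `W/ℚ` globally minimal with `X2.CellB W 3`, `3` non-split, a rational line `Φ₀ ≤ W[3]` RAMIFIED at
`3` and ODD with primitive `φ` (mod `m`, `3 ∣ m`), `ψ` (mod `d`, `3 ∤ d`), and `S₀ ∌ (3)` off which `W` is good with
LOCAL BALANCE ONE: the conclusion of `stub_upperPartner` at `(W, 3)`, VERBATIM. `ψ` is quadratic (`𝔽₃`), even
(`…LineWeilRelation.even_quot_of_lineOdd`) with `ψ(3) = −1` (w7), so `exists_admissibleField_coprime_classNumber`
supplies `K`; then §1 (`_of_thmE`). Inputs BY NAME: `PublishedInputs`, Disegni Thm. 4(1), GV Thm. (3.11), Dokchitser,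
Nakagawa–Horie–Taya (PUB); Keller–Yin Thm. E (PRE). No analytic rank, `p`-adic `L`-function, height or Schneider
hypothesis of any curve is an input. [claim: KellerYin2024, status: under-review] [cite: NakagawaHorie1988, Thm. 1]
[cite: KrizLi2019, §9 Thm. 9.4 (first assertion) and its proof] [cite: GreenbergVatsal2000, §3 Thm. (3.11) (p. 43)]
[cite: DokchitserDokchitserAnnals2010, Thm. 1.4] [cite: Disegni2020, Thm. 4 (§3.2)] [cite: Wuthrich2014, Thm. 16 (p. 397)] -/
theorem upperPartner_at_three_of_ramifiedOdd_of_thmE (hP : EisensteinPrimes.PublishedInputs)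
    (hDis : padicBSD_rankOne_nonsplitMult) (h311 : thm311_hasUnitContent_iff_and_order_eq_of_lineRamifiedEven)
    (hDD : ∀ (V : WeierstrassCurve ℚ) [V.IsElliptic] (ℓ : ℕ) [Fact ℓ.Prime], selmerCorank_mod_two_eq V ℓ)
    (hKY : thmE_pConverse_semistable_OPEN)
    (hNH : Literature.NumberTheory.QuadraticFields.nakagawaHorie_taya_exists_imaginary_h3_eq_one)
    (hc : X2.CellB W 3) (hns : ¬ W.HasSplitMultiplicativeReductionAtPrime 3)
    {Φ₀ : AddSubgroup (geomTorsion W (3 : ℤ))} (hΦ : IsRationalLine W 3 Φ₀)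
    (hram : ¬ LineUnramifiedAt W 3 Φ₀) (hodd : LineOdd W 3 Φ₀)
    {m : ℕ} [NeZero m] (φ : DirichletCharacter (ZMod 3) m) {d : ℕ} [NeZero d]
    (ψ : DirichletCharacter (ZMod 3) d) (hφ : φ.IsPrimitive) (hψ : ψ.IsPrimitive) (hpm : 3 ∣ m)
    (hpd : ¬ 3 ∣ d)
    (hφ0 : ∀ (σ : absoluteGaloisGroup ℚ), ∀ P ∈ Φ₀,
      σ • P = (φ ((modNCyclotomicCharacter ℚ m σ : (ZMod m)ˣ) : ZMod m)).val • P)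
    (hψ0 : ∀ (σ : absoluteGaloisGroup ℚ) (P : geomTorsion W (3 : ℤ)),
      σ • P - (ψ ((modNCyclotomicCharacter ℚ d σ : (ZMod d)ˣ) : ZMod d)).val • P ∈ Φ₀)
    (S₀ : Finset (HeightOneSpectrum (𝓞 ℚ))) (hS₀p : ∀ v ∈ S₀, ((3 : ℕ) : 𝓞 ℚ) ∉ v.asIdeal)
    (hS : ∀ v : HeightOneSpectrum (𝓞 ℚ), v ∉ S₀ → ((3 : ℕ) : 𝓞 ℚ) ∉ v.asIdeal → W.HasGoodReductionAt v)
    (hbal : 1 + ∑ v ∈ S₀, delta W 3 v =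
      ∑ v ∈ S₀, ((if φ (Rat.HeightOneSpectrum.natGenerator v : ZMod m) =
            (Rat.HeightOneSpectrum.natGenerator v : ZMod 3)
          then sFactor 3 (Rat.HeightOneSpectrum.natGenerator v) else 0) +
        (if ψ (Rat.HeightOneSpectrum.natGenerator v : ZMod d) =
            (Rat.HeightOneSpectrum.natGenerator v : ZMod 3)
          then sFactor 3 (Rat.HeightOneSpectrum.natGenerator v) else 0))) :
    ∃ (K : Type) (_ : Field K) (_ : NumberField K), IsImaginaryQuadratic K ∧
      SatisfiesHeegnerHypothesis (W.conductorNorm ℤ) K ∧ SatisfiesHeegnerHypothesis 3 K ∧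
      Odd (NumberField.discr K) ∧ NumberField.discr K < -4 ∧
      (W.quadraticTwist (NumberField.discr K : ℚ)).analyticRank = 1 ∧
      ∀ (Wd : WeierstrassCurve ℚ) [Wd.IsElliptic] [Wd.IsGloballyMinimal],
        (∃ C : VariableChange ℚ, C • Wd = W.quadraticTwist (NumberField.discr K : ℚ)) →
        MissingUpperBoundAt Wd 3 := by
  have hevenψ : ψ.Even := even_quot_of_lineOdd hΦ hodd hφ0 hψ0
  have hψ3 : ψ (3 : ZMod d) = -1 :=
    psi_natCast_eq_neg_one_of_not_split (W := W) (p := 3) (by decide) hc.2.1.2.2 hns hΦ hram ψ hpd hψ0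
  obtain ⟨K, _, _, hK, hHN, hH3, hoddK, hlt, ⟨N₀, hHN₀, hS₀N₀⟩, hmK, hdK, hh⟩ :=
    exists_admissibleField_coprime_classNumber hNH (W.conductorNorm ℤ) W.conductorNorm_pos_holds m ψ hψ hevenψ
      hψ3 S₀
  exact upperPartner_at_of_ramifiedOdd_of_classNumber_of_thmE W 3 hP hDis h311 hDD hKY hc hns hΦ hram hodd φ ψ hφ
    hψ hpm hpd (isQuadratic_of_zmod_three ψ) hφ0 hψ0 S₀ hS₀p hS hbal K hK hHN hH3 hoddK hlt hHN₀ hS₀N₀ hmK hdK hh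

/-- **Stub 6 (∃-PARTNER) at EVERY non-split X2b pair `(W, 3)` with a balance-one UNRAMIFIED-EVEN line datum — `K`
CHOSEN** (second shape: `φ` even, `φ(3) = −1` by w7's `phi_natCast_eq_neg_one_of_not_split_of_lineUnramifiedAt`;
supply at `n = m`; §2 `_of_thmE`). Same inputs BY NAME. [claim: KellerYin2024, status: under-review]
[cite: NakagawaHorie1988, Thm. 1] [cite: KrizLi2019, §9 Thm. 9.4 (first assertion)] [cite: GreenbergVatsal2000, §3 Thm. (3.11) and §2 p. 28]
[cite: DokchitserDokchitserAnnals2010, Thm. 1.4] [cite: Disegni2020, Thm. 4 (§3.2)] [cite: Wuthrich2014, Thm. 16 (p. 397)] -/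
theorem upperPartner_at_three_of_unramifiedEven_of_thmE (hP : EisensteinPrimes.PublishedInputs)
    (hDis : padicBSD_rankOne_nonsplitMult) (h311 : thm311_hasUnitContent_iff_and_order_eq_of_lineRamifiedEven)
    (hDD : ∀ (V : WeierstrassCurve ℚ) [V.IsElliptic] (ℓ : ℕ) [Fact ℓ.Prime], selmerCorank_mod_two_eq V ℓ)
    (hKY : thmE_pConverse_semistable_OPEN)
    (hNH : Literature.NumberTheory.QuadraticFields.nakagawaHorie_taya_exists_imaginary_h3_eq_one)
    (hc : X2.CellB W 3) (hns : ¬ W.HasSplitMultiplicativeReductionAtPrime 3)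
    {Φ₀ : AddSubgroup (geomTorsion W (3 : ℤ))} (hΦ : IsRationalLine W 3 Φ₀)
    (hunr : LineUnramifiedAt W 3 Φ₀) (heven : LineEven W 3 Φ₀)
    {m : ℕ} [NeZero m] (φ : DirichletCharacter (ZMod 3) m) {d : ℕ} [NeZero d]
    (ψ : DirichletCharacter (ZMod 3) d) (hφ : φ.IsPrimitive) (hψ : ψ.IsPrimitive) (hpm : ¬ 3 ∣ m)
    (hpd : 3 ∣ d)
    (hφ0 : ∀ (σ : absoluteGaloisGroup ℚ), ∀ P ∈ Φ₀,
      σ • P = (φ ((modNCyclotomicCharacter ℚ m σ : (ZMod m)ˣ) : ZMod m)).val • P)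
    (hψ0 : ∀ (σ : absoluteGaloisGroup ℚ) (P : geomTorsion W (3 : ℤ)),
      σ • P - (ψ ((modNCyclotomicCharacter ℚ d σ : (ZMod d)ˣ) : ZMod d)).val • P ∈ Φ₀)
    (S₀ : Finset (HeightOneSpectrum (𝓞 ℚ))) (hS₀p : ∀ v ∈ S₀, ((3 : ℕ) : 𝓞 ℚ) ∉ v.asIdeal)
    (hS : ∀ v : HeightOneSpectrum (𝓞 ℚ), v ∉ S₀ → ((3 : ℕ) : 𝓞 ℚ) ∉ v.asIdeal → W.HasGoodReductionAt v)
    (hbal : 1 + ∑ v ∈ S₀, delta W 3 v =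
      ∑ v ∈ S₀, ((if φ (Rat.HeightOneSpectrum.natGenerator v : ZMod m) =
            (Rat.HeightOneSpectrum.natGenerator v : ZMod 3)
          then sFactor 3 (Rat.HeightOneSpectrum.natGenerator v) else 0) +
        (if ψ (Rat.HeightOneSpectrum.natGenerator v : ZMod d) =
            (Rat.HeightOneSpectrum.natGenerator v : ZMod 3)
          then sFactor 3 (Rat.HeightOneSpectrum.natGenerator v) else 0))) :
    ∃ (K : Type) (_ : Field K) (_ : NumberField K), IsImaginaryQuadratic K ∧
      SatisfiesHeegnerHypothesis (W.conductorNorm ℤ) K ∧ SatisfiesHeegnerHypothesis 3 K ∧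
      Odd (NumberField.discr K) ∧ NumberField.discr K < -4 ∧
      (W.quadraticTwist (NumberField.discr K : ℚ)).analyticRank = 1 ∧
      ∀ (Wd : WeierstrassCurve ℚ) [Wd.IsElliptic] [Wd.IsGloballyMinimal],
        (∃ C : VariableChange ℚ, C • Wd = W.quadraticTwist (NumberField.discr K : ℚ)) →
        MissingUpperBoundAt Wd 3 := by
  have hevenφ : φ.Even := even_of_lineEven hΦ heven hφ0
  have hφ3 : φ (3 : ZMod m) = -1 :=
    phi_natCast_eq_neg_one_of_not_split_of_lineUnramifiedAt (W := W) (p := 3) (by decide) hc.2.1.2.2 hns hΦ hunr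
      φ hpm hφ0
  obtain ⟨K, _, _, hK, hHN, hH3, hoddK, hlt, ⟨N₀, hHN₀, hS₀N₀⟩, hdK, hmK, hh⟩ :=
    exists_admissibleField_coprime_classNumber hNH (W.conductorNorm ℤ) W.conductorNorm_pos_holds d φ hφ hevenφ
      hφ3 S₀
  exact upperPartner_at_of_unramifiedEven_of_classNumber_of_thmE W 3 hP hDis h311 hDD hKY hc hns hΦ hunr heven φ ψ
    hφ hψ hpm hpd (isQuadratic_of_zmod_three φ) hφ0 hψ0 S₀ hS₀p hS hbal K hK hHN hH3 hoddK hlt hHN₀ hS₀N₀ hmK hdK hh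

end Three

end Summit.BirchSwinnertonDyer.BirchSwinnertonDyer.Theorems.EisensteinPrimesMazurMCOnCellBTwistbackSubrowPartner

end
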